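import Summits.KontsevichZagierPeriods.KontsevichZagierPeriods.Theorems.SoloInformedEquidimStability
import Summits.KontsevichZagierPeriods.KontsevichZagierPeriods.Theorems.SoloInformedFlattening
import Literature.NumberTheory.Transcendental.KZRulesAssociator
import HarnessLib
import HarnessLib.Audit

/-!
# SoloInformed — `relations₁₂` is associative and unital modulo; `relations₁₂ ⊔ U` is an ideal (Newton–Leibniz elimination, file 1b-D)

Solo programme `solo-KontsevichZagierPeriods-informed`, session s245 (K-NF file 1b-D of the
kernel programme of THEOREM NF, `paper/nl-elimination.md` §7; COROLLARY NF.3).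

`Literature/NumberTheory/Transcendental/KZRulesAssociator.lean` shows that the Fubini product on
`FormalRep` is associative and unital modulo `KZ.relations`, because `(r × s) × u` and
`[pt,1] × s` ARE coordinate relabellings of `r × (s × u)` and `s`
(`IntegralRep.prod_prod_eq_reindex`, `IntegralRep.unit_prod_eq_reindex`).  A relabelling is a
set-level change-of-variables move (`soloInformed_of_sub_of_reindex_mem_changeOfVariablesRel`,
file 1b-A), so the same holds modulo the equidimensional relations
`relations₁₂ = soloInformedEquidimRelations` — no Newton–Leibniz move is involved:

* `soloInformed_mul_assoc_sub_mem_equidimRelations`, `soloInformed_of_unit_mul_sub_mem_equidimRelations`,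
  `soloInformed_mul_of_unit_sub_mem_equidimRelations` — with file 1b-A, `FormalRep ⧸ relations₁₂`
  is a commutative ring graded by dimension;
* **COROLLARY NF.3 (kernel form, unconditional part)**: the flattening operator commutes with
  multiplication modulo `relations₁₂`, `Fl (c * d) ≡ c * Fl d ≡ Fl c * d`
  (`soloInformed_flatMap_mul_sub_mul_flatMap_mem`, `soloInformed_flatMap_mul_sub_flatMap_mul_mem`),
  in particular disc insertion `[π] * ·` commutes with flattening
  (`soloInformed_flatMap_piRep_mul_sub_mem`);
* **`relations₁₂ ⊔ U` is a two-sided ideal of `FormalRep`, unconditionally**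
  (`soloInformed_mul_mem_sup_left/right`, `soloInformed_mul_sub_mul_mem_sup`): the stabilised
  equidimensional quotient `FormalRep ⧸ (relations₁₂ ⊔ U)` is a commutative ring mapping onto the
  formal period ring `KZ.FormalPeriodRing = FormalRep ⧸ relations`, and THEOREM NF
  (`SoloInformedNLElimination`) says exactly that this map is an isomorphism.

References: M. Kontsevich, D. Zagier, *Periods* (2001), §1.2, §4.1; this work (THEOREM NF,
COROLLARY NF.3, `paper/nl-elimination.md`).
-/

noncomputable section

open scoped BigOperators

namespace Summit.KontsevichZagierPeriods.KontsevichZagierPeriods.Theorems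

open Set MeasureTheory
open Literature.ModelTheory.ExponentialFields
open Literature.NumberTheory.Transcendental Literature.NumberTheory.Transcendental.KZ

variable {n m l k : ℕ}

/-! ### Associativity and unit modulo `relations₁₂` -/

/-- **Associativity modulo `relations₁₂`, on generators**:
`([r] * [s]) * [u] − [r] * ([s] * [u]) ∈ relations₁₂` (the relabelling
`IntegralRep.prod_prod_eq_reindex` is a set-level change-of-variables move).
[Kontsevich–Zagier 2001, §4.1; this work] -/
theorem soloInformed_of_mul_of_mul_of_sub_mem_equidimRelations (r : IntegralRep n)
    (s : IntegralRep m) (u : IntegralRep l) :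
    of r * of s * of u - of r * (of s * of u) ∈ soloInformedEquidimRelations := by
  rw [of_mul_of, of_mul_of, of_mul_of, of_mul_of, IntegralRep.prod_prod_eq_reindex, ← neg_sub]
  exact soloInformedEquidimRelations.neg_mem
    (soloInformed_changeOfVariablesRel_subset_equidimRelations
      (soloInformed_of_sub_of_reindex_mem_changeOfVariablesRel _ _))

/-- The values of an additive map `FormalRep →+ FormalRep` lie in `relations₁₂` as soon as its
values on the generators do. [folklore] -/
theorem soloInformed_map_mem_equidimRelations_of_forall_of (f : FormalRep →+ FormalRep)
    (h : ∀ (n : ℕ) (r : IntegralRep n), f (of r) ∈ soloInformedEquidimRelations) (x : FormalRep) :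
    f x ∈ soloInformedEquidimRelations := by
  induction x using FreeAbelianGroup.induction_on with
  | zero => rw [map_zero]; exact soloInformedEquidimRelations.zero_mem
  | of X => obtain ⟨n, r⟩ := X; exact h n r
  | neg X ih => rw [map_neg]; exact soloInformedEquidimRelations.neg_mem ih
  | add X Y hX hY => rw [map_add]; exact soloInformedEquidimRelations.add_mem hX hY

/-- **Associativity modulo `relations₁₂`**: `(x * y) * z − x * (y * z) ∈ relations₁₂` for all formal
combinations (triadditivity from the generator case, as in `KZ.mul_assoc_sub_mem_relations`).
[Kontsevich–Zagier 2001, §4.1; this work] -/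
theorem soloInformed_mul_assoc_sub_mem_equidimRelations (x y z : FormalRep) :
    x * y * z - x * (y * z) ∈ soloInformedEquidimRelations := by
  refine soloInformed_map_mem_equidimRelations_of_forall_of
    ((AddMonoidHom.mulRight z).comp (AddMonoidHom.mulRight y) - AddMonoidHom.mulRight (y * z))
    (fun n r => ?_) x
  change of r * y * z - of r * (y * z) ∈ soloInformedEquidimRelations
  refine soloInformed_map_mem_equidimRelations_of_forall_of
    ((AddMonoidHom.mulRight z).comp (AddMonoidHom.mulLeft (of r)) -
      (AddMonoidHom.mulLeft (of r)).comp (AddMonoidHom.mulRight z))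
    (fun m s => ?_) y
  change of r * of s * z - of r * (of s * z) ∈ soloInformedEquidimRelations
  refine soloInformed_map_mem_equidimRelations_of_forall_of
    (AddMonoidHom.mulLeft (of r * of s) -
      (AddMonoidHom.mulLeft (of r)).comp (AddMonoidHom.mulLeft (of s)))
    (fun l u => ?_) z
  exact soloInformed_of_mul_of_mul_of_sub_mem_equidimRelations r s u

/-- **Left unit modulo `relations₁₂`**: `[pt, 1] * c − c ∈ relations₁₂`
(`IntegralRep.unit_prod_eq_reindex` is a set-level change-of-variables move).
[Kontsevich–Zagier 2001, §4.1; this work] -/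
theorem soloInformed_of_unit_mul_sub_mem_equidimRelations (c : FormalRep) :
    of IntegralRep.unit * c - c ∈ soloInformedEquidimRelations := by
  induction c using FreeAbelianGroup.induction_on with
  | zero => simp [soloInformedEquidimRelations.zero_mem]
  | of x =>
    obtain ⟨m, s⟩ := x
    change of IntegralRep.unit * of s - of s ∈ soloInformedEquidimRelations
    rw [of_mul_of, IntegralRep.unit_prod_eq_reindex, ← neg_sub]
    exact soloInformedEquidimRelations.neg_mem
      (soloInformed_changeOfVariablesRel_subset_equidimRelations
        (soloInformed_of_sub_of_reindex_mem_changeOfVariablesRel _ _))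
  | neg x ih =>
    have : of IntegralRep.unit * -FreeAbelianGroup.of x - -FreeAbelianGroup.of x =
        -(of IntegralRep.unit * FreeAbelianGroup.of x - FreeAbelianGroup.of x) := by
      rw [mul_neg]; abel
    rw [this]; exact soloInformedEquidimRelations.neg_mem ih
  | add x y hx hy =>
    have : of IntegralRep.unit * (x + y) - (x + y) =
        (of IntegralRep.unit * x - x) + (of IntegralRep.unit * y - y) := by
      rw [mul_add]; abel
    rw [this]; exact soloInformedEquidimRelations.add_mem hx hy

/-- **Right unit modulo `relations₁₂`**: `c * [pt, 1] − c ∈ relations₁₂`. [Kontsevich–Zagier 2001,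
§4.1; this work] -/
theorem soloInformed_mul_of_unit_sub_mem_equidimRelations (c : FormalRep) :
    c * of IntegralRep.unit - c ∈ soloInformedEquidimRelations := by
  have h := soloInformedEquidimRelations.add_mem
    (soloInformed_mul_comm_mem_equidimRelations c (of IntegralRep.unit))
    (soloInformed_of_unit_mul_sub_mem_equidimRelations c)
  simpa using h

/-! ### COROLLARY NF.3: flattening commutes with multiplication modulo `relations₁₂` -/

/-- **`Fl (c * d) ≡ c * Fl d (mod relations₁₂)`** (associativity). [this work, COROLLARY NF.3] -/
theorem soloInformed_flatMap_mul_sub_mul_flatMap_mem (c d : FormalRep) :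
    soloInformedFlatMap (c * d) - c * soloInformedFlatMap d ∈ soloInformedEquidimRelations := by
  rw [soloInformed_flatMap_apply, soloInformed_flatMap_apply]
  exact soloInformed_mul_assoc_sub_mem_equidimRelations c d _

/-- **`Fl (c * d) ≡ Fl c * d (mod relations₁₂)`** (associativity twice and commutativity inside a
left product). [this work, COROLLARY NF.3] -/
theorem soloInformed_flatMap_mul_sub_flatMap_mul_mem (c d : FormalRep) :
    soloInformedFlatMap (c * d) - soloInformedFlatMap c * d ∈ soloInformedEquidimRelations := by
  rw [soloInformed_flatMap_apply, soloInformed_flatMap_apply]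
  set ι := of soloInformedUnitIntervalRep with hι
  have h1 := soloInformed_mul_assoc_sub_mem_equidimRelations c d ι
  have h2 := soloInformed_mul_mem_equidimRelations_left c
    (soloInformed_mul_comm_mem_equidimRelations d ι)
  have h3 := soloInformed_mul_assoc_sub_mem_equidimRelations c ι d
  have e : c * d * ι - c * ι * d =
      (c * d * ι - c * (d * ι)) + c * (d * ι - ι * d) - (c * ι * d - c * (ι * d)) := by
    rw [mul_sub]; abel
  rw [e]
  exact soloInformedEquidimRelations.sub_mem (soloInformedEquidimRelations.add_mem h1 h2) h3

/-- `Fl^k (c * d) ≡ c * Fl^k d (mod relations₁₂)`. [this work, COROLLARY NF.3] -/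
theorem soloInformed_flatPow_mul_sub_mul_flatPow_mem (k : ℕ) (c d : FormalRep) :
    soloInformedFlatPow k (c * d) - c * soloInformedFlatPow k d ∈ soloInformedEquidimRelations := by
  induction k with
  | zero => simp [soloInformedEquidimRelations.zero_mem]
  | succ k ih =>
    rw [soloInformed_flatPow_succ_apply, soloInformed_flatPow_succ_apply]
    have h1 : soloInformedFlatMap (soloInformedFlatPow k (c * d)) -
        soloInformedFlatMap (c * soloInformedFlatPow k d) ∈ soloInformedEquidimRelations := by
      rw [← map_sub, soloInformed_flatMap_apply]
      exact soloInformed_mul_mem_equidimRelations_right _ ih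
    have h := soloInformedEquidimRelations.add_mem h1
      (soloInformed_flatMap_mul_sub_mul_flatMap_mem c (soloInformedFlatPow k d))
    rwa [sub_add_sub_cancel] at h

/-- **COROLLARY NF.3 (disc insertion commutes with flattening)**:
`Fl ([π] * c) − [π] * Fl c ∈ relations₁₂`. [this work, COROLLARY NF.3] -/
theorem soloInformed_flatMap_piRep_mul_sub_mem (c : FormalRep) :
    soloInformedFlatMap (of piRep * c) - of piRep * soloInformedFlatMap c ∈
      soloInformedEquidimRelations :=
  soloInformed_flatMap_mul_sub_mul_flatMap_mem _ _

/-! ### `relations₁₂ ⊔ U` is a two-sided ideal, unconditionally -/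

/-- **Left products preserve `relations₁₂ ⊔ U`**: `x ∈ relations₁₂ ⊔ U → c * x ∈ relations₁₂ ⊔ U`
(`c * (Fl y − y) = (c * Fl y − Fl (c * y)) + (Fl (c * y) − c * y)`). [this work, THEOREM NF] -/
theorem soloInformed_mul_mem_sup_left (c : FormalRep) {x : FormalRep}
    (hx : x ∈ soloInformedEquidimRelations ⊔ soloInformedFlatSpan) :
    c * x ∈ soloInformedEquidimRelations ⊔ soloInformedFlatSpan := by
  obtain ⟨ρ, hρ, u, hu, rfl⟩ := AddSubgroup.mem_sup.mp hx
  obtain ⟨y, rfl⟩ := (soloInformed_mem_flatSpan_iff u).mp hu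
  rw [mul_add]
  refine (soloInformedEquidimRelations ⊔ soloInformedFlatSpan).add_mem
    (AddSubgroup.mem_sup_left (soloInformed_mul_mem_equidimRelations_left c hρ)) ?_
  have e : c * (soloInformedFlatMap y - y) =
      (c * soloInformedFlatMap y - soloInformedFlatMap (c * y)) + (soloInformedFlatMap (c * y) - c * y) := by
    rw [mul_sub]; abel
  rw [e]
  refine (soloInformedEquidimRelations ⊔ soloInformedFlatSpan).add_mem
    (AddSubgroup.mem_sup_left ?_)
    (AddSubgroup.mem_sup_right (soloInformed_flatMap_sub_self_mem_flatSpan (c * y)))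
  have h := soloInformedEquidimRelations.neg_mem (soloInformed_flatMap_mul_sub_mul_flatMap_mem c y)
  rwa [neg_sub] at h

/-- **Right products preserve `relations₁₂ ⊔ U`**: `x ∈ relations₁₂ ⊔ U → x * c ∈ relations₁₂ ⊔ U`
(commutativity modulo `relations₁₂`). [this work, THEOREM NF] -/
theorem soloInformed_mul_mem_sup_right (c : FormalRep) {x : FormalRep}
    (hx : x ∈ soloInformedEquidimRelations ⊔ soloInformedFlatSpan) :
    x * c ∈ soloInformedEquidimRelations ⊔ soloInformedFlatSpan := by
  have h := (soloInformedEquidimRelations ⊔ soloInformedFlatSpan).add_mem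
    (AddSubgroup.mem_sup_left (soloInformed_mul_comm_mem_equidimRelations x c))
    (soloInformed_mul_mem_sup_left c hx)
  simpa using h

/-- **`relations₁₂ ⊔ U` is a two-sided ideal**: `c₁ − c₂, d₁ − d₂ ∈ relations₁₂ ⊔ U →
c₁ * d₁ − c₂ * d₂ ∈ relations₁₂ ⊔ U`; so `FormalRep ⧸ (relations₁₂ ⊔ U)` is a (commutative, unital,
associative) ring mapping onto `KZ.FormalPeriodRing`, isomorphically iff `SoloInformedNLElimination`.
[this work, THEOREM NF] -/
theorem soloInformed_mul_sub_mul_mem_sup {c₁ c₂ d₁ d₂ : FormalRep}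
    (hc : c₁ - c₂ ∈ soloInformedEquidimRelations ⊔ soloInformedFlatSpan)
    (hd : d₁ - d₂ ∈ soloInformedEquidimRelations ⊔ soloInformedFlatSpan) :
    c₁ * d₁ - c₂ * d₂ ∈ soloInformedEquidimRelations ⊔ soloInformedFlatSpan := by
  have e : c₁ * d₁ - c₂ * d₂ = (c₁ - c₂) * d₁ + c₂ * (d₁ - d₂) := by
    simp only [sub_mul, mul_sub]; abel
  rw [e]
  exact (soloInformedEquidimRelations ⊔ soloInformedFlatSpan).add_mem
    (soloInformed_mul_mem_sup_right d₁ hc) (soloInformed_mul_mem_sup_left c₂ hd)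

/-- `Fl` preserves `relations₁₂ ⊔ U`. [this work] -/
theorem soloInformed_flatMap_mem_sup {x : FormalRep}
    (hx : x ∈ soloInformedEquidimRelations ⊔ soloInformedFlatSpan) :
    soloInformedFlatMap x ∈ soloInformedEquidimRelations ⊔ soloInformedFlatSpan := by
  rw [soloInformed_flatMap_apply]
  exact soloInformed_mul_mem_sup_right _ hx

/-- `relations₁₂ ⊔ U` sits between `relations₁₂` and `relations`, is an ideal containing the unit
defect: `[pt,1] * c − c ∈ relations₁₂ ⊔ U`. [this work] -/
theorem soloInformed_of_unit_mul_sub_mem_sup (c : FormalRep) :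
    of IntegralRep.unit * c - c ∈ soloInformedEquidimRelations ⊔ soloInformedFlatSpan :=
  AddSubgroup.mem_sup_left (soloInformed_of_unit_mul_sub_mem_equidimRelations c)

end Summit.KontsevichZagierPeriods.KontsevichZagierPeriods.Theorems
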